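import Literature.MathematicalPhysics.QuantumFieldTheory.BalabanImbrieJaffe1984to88.BIJ88WalkFormIntegrated5133
import Literature.MathematicalPhysics.QuantumFieldTheory.BalabanImbrieJaffe1984to88.BIJ88SlotFactorsSmooth308

/-!
# `BalabanImbrieJaffe1984to88.BIJ88WalkFormLocated309` — T. Bałaban, J. Imbrie, A. Jaffe, *Effective action and cluster properties of
the abelian Higgs model*, Commun. Math. Phys. **114** (1988) 257–315 [BalabanImbrieJaffe1988]: pp. 308–309 [PDF 52–53] (Sect. 5.14) —
**THE INTEGRATED WALK FORM (5.13.3) HOLDS FOR THE LOCATED DERIVATIVE OBSERVABLES OF THE DECOUPLING EXPANSION**.  Print, p. 308: *"We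
cluster expand as before each integral making up the truncated expectation values ⟨(d/dt)_{γ₁}; …; (d/dt)_{γₙ} + 1⟩_t"* and p. 309: *"The
proof of this estimate is similar to the one for g₂. We mention only the new features."* — i.e. each factor `⟨Π_{i∈H_β}(d/dt)_{γ_i}⟩` of
(5.14.3) is expanded by THE SAME random-walk / integration-by-parts identity (5.13.3) of Sect. 5.13 (p. 306: *"⟨Π_{i∈I} f(□_i)⟩_1 =
Σ_{Γ⊂I} ∫ds_Γ Σ_{π∈𝒫(Γ)} ⟨Π_{α∈π}[Σ_{ω(α)} ⟨δ/δΦ, C_s□Δ□C_s ⋯ C_s(½δ/δΦ + ℱ)⟩] Π_{i∈I} f(□_i)⟩_{s_Γ}"*), now with the cube factors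
`f(□_i)` = the located derivative observables of p. 308 (the product over the slots located in `□_i` of the t-differentiated χ-factors
and `e^{−tV(Y)}`-factors).  In the tree (5.13.3) integrated is p13's `BIJ88WalkFormIntegrated5133.expect_one_eq_expansionSum_trains_of_cbInf`
for cube factors in the smooth class `CbInf`; p36's `BIJ88SlotFactorsSmooth308.cbInf_fD_uD` (gen 20) puts the located derivative
observables `BIJ88Expansion5143Gauss.fD (BIJ88SlotMomentsGauss308.uD …)` in that class.  THIS FILE COMPOSES THE TWO: the literal
integrated (5.13.3) for `⟨Π_{□_i⊂X} fD_K(□_i)⟩_{1,X}` — the typed starting point of print's route to (5.14.4) in EVERY cube (SUCCESSOR-g21 §f;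
owner r16 value item (3) «χ-slots in every cube»), complementary to the conditioning engine `BIJ88ActInFarCube309` of the chain instances
(which cannot see χ-factors in the far cube).

statement-level skeleton of published theorems with citation tags; proofs where landed; nothing here is a claim about the Yang–Mills mass gap

PDF held: `paper:balaban1988-cmp114-bij-abelian-higgs-effective-action` (journal page = PDF page + 256); pages re-read this session as text:
PDF 52 (p. 308) L29–31, PDF 53 (p. 309) L15–16, PDF 50 (p. 306) (5.13.3) via p13's header.

CITATION HEADER (lean-in-tree rule).  Part of the lit-balaban TYPED SKELETON (HOME `run/shared/lean/pub/lit-balaban/`), Phase 2, seat p36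
(gen 20, unit `lit-balaban-p36`); rows **C2.Eq5.14.3-5.14.4** (member: §f starting identity) and C2.Eq5.13.3-5.13.4 (p13's integrated walk
form, instantiated) of `HOME/lit-balaban-r16/ROWS-C2-part2.md`.  WHAT IS REPRODUCED (theorem-only; no definitions, no `Prop` facts; axioms
standard): **`expect_fD_uD_eq_expansionSum_trains`** — for `Δ ≻ 0` with form bounds `c₀ ≤ Δ ≤ C₀`, any source `ℱ`, linear slot fields
`Φ_b` with `c_b ≠ 0`, `V_Y ∈ C_b^∞`, `t` on the branch `0 < t`, `te_k < 1`, every slot set `K` and every region `X` with a site: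
`⟨Π_{□_i⊂X} fD_K(□_i)⟩_{1,X} = Σ_{Γ⊂I} ∫ds_Γ Σ_{σ∈smallParts Γ} (−1)^{|σ|} Σ_{P∈setPartitions σ} ⟨(Π_{c∈P} 𝕋_c) Π_{□_i⊂X} fD_K(□_i)⟩_{s_Γ,X}`
VERBATIM in p13's rendering (trains `𝕋_c`, corrected vertices, `expansionSum` at base point `0`).
HONEST SCOPE.  An identity, no estimate: the per-cube small factors of (5.14.4) (t-derivatives: `BIJ88ChiTDerivN309`; field derivatives on the
shell: `BIJ88SlotFactorsShell309`, `BIJ88ChiFieldDeriv307`) and the walk/partition combinatorics of p. 307 are the successor's §f proper.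
The hypothesis `V_Y ∈ C_b^∞` is the walk form's typing (print: *"a small polynomial"*, bounded on the χ-support only).
-/

namespace Literature.MathematicalPhysics.QuantumFieldTheory.BalabanImbrieJaffe1984to88.BIJ88WalkFormLocated309

open Finset Matrix
open scoped BigOperators
open Literature.Probability.LatticeModels (setPartitions)
open BIJ88FTCExpansion305 (expansionSum)
open BIJ88PairingAllOrders5133 (smallParts)
open BIJ88TruncationConnected306 (gexp)
open BIJ88TruncationConnected5133 (bmat)
open BIJ88WalkForm5133 (trains)
open BIJ88PolymerRep5134Gauss (obs prec src)
open BIJ88SmoothFactors5133 (CbInf)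
open BIJ88Sect5Statements (CutoffProfile)
open BIJ88Expansion5143Gauss (fD)
open BIJ88SlotMomentsGauss308 (uD)

variable {α I : Type} [Fintype α] [DecidableEq α] [Fintype I] [DecidableEq I] (blk : α → I) {Δ : Matrix α α ℝ} (ℱ : α → ℝ)
variable (χ : CutoffProfile) {ι υ : Type} [DecidableEq ι] [DecidableEq υ] (p : ℝ) {ek t : ℝ} (B : Finset ι)
  {Φ : ι → (α → ℝ) → ℝ} {c : ι → ℝ} (Ys : Finset υ) {V : υ → (α → ℝ) → ℝ} (cube : ↥B ⊕ ↥Ys → I) {S : Type*} (γ : S → ↥B ⊕ ↥Ys)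

/-- **(5.13.3) INTEGRATED FOR THE LOCATED DERIVATIVE OBSERVABLES OF p. 308** (p. 308: *"We cluster expand as before each integral making
up the truncated expectation values"*): the region expectation `⟨Π_{□_i⊂X} fD_K(□_i)⟩_{1,X}` of p25's derivative observables on p36's slot
data equals p13's train expansion — `BIJ88WalkFormIntegrated5133.expect_one_eq_expansionSum_trains_of_cbInf` fed with
`BIJ88SlotFactorsSmooth308.cbInf_fD_uD`. [cite: BalabanImbrieJaffe1988, (5.14.3) p.308, §5.13 Eq. (5.13.3) p.306] -/
theorem expect_fD_uD_eq_expansionSum_trains (hΔ : Δ.PosDef) {c₀ C₀ : ℝ} (hc₀ : 0 < c₀)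
    (hcΔ : ∀ v, c₀ * (v ⬝ᵥ v) ≤ v ⬝ᵥ (Δ *ᵥ v)) (hCΔ : ∀ v, v ⬝ᵥ (Δ *ᵥ v) ≤ C₀ * (v ⬝ᵥ v))
    (hek : 0 < ek) (ht : 0 < t) (h1 : t * ek < 1) (hΦ : ∀ b ∈ B, IsLinearMap ℝ (Φ b)) (hc : ∀ b ∈ B, c b ≠ 0)
    (hV : ∀ Y ∈ Ys, CbInf (V Y)) (K : Finset S) (X : Finset I) (hX : ∃ x, blk x ∈ X) :
    BIJ88PolymerRep5134Gauss.expect blk Δ ℱ (fD (uD χ p ek B Φ c Ys V t) cube γ K) X (fun _ => 1)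
      = expansionSum (univ : Finset I).toList
          (fun Γ s => ∑ σ ∈ smallParts Γ, (-1 : ℝ) ^ σ.card *
            ∑ P ∈ setPartitions σ, gexp (prec blk Δ X s) (src blk ℱ X)
              (trains (src blk ℱ X) (prec blk Δ X s)⁻¹
                (fun b => bmat (fun x : BIJ88PolymerRep5134Gauss.Site blk X => blk x.1) (Δ.submatrix Subtype.val Subtype.val) s b
                  + (bmat (fun x : BIJ88PolymerRep5134Gauss.Site blk X => blk x.1) (Δ.submatrix Subtype.val Subtype.val) s b)ᵀ)
                P.toList (obs blk (fD (uD χ p ek B Φ c Ys V t) cube γ K) X))) 0 :=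
  BIJ88WalkFormIntegrated5133.expect_one_eq_expansionSum_trains_of_cbInf blk ℱ _ hΔ hc₀ hcΔ hCΔ
    (fun i => BIJ88SlotFactorsSmooth308.cbInf_fD_uD χ p B Ys hek ht h1 hΦ hc hV cube γ K i) X hX

end Literature.MathematicalPhysics.QuantumFieldTheory.BalabanImbrieJaffe1984to88.BIJ88WalkFormLocated309
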